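import Literature.Algebra.EuclideanLattices.SmoothingGaussianFourier
import HarnessLib

/-!
# Regev 2009, Lemma 3.14: the Fourier transform over `ℤ_Rⁿ` of a periodic Gaussian state is the dual periodic Gaussian

Topic `Algebra/EuclideanLattices` (family `pqc`). Serves the decomposition of the named fact
`Literature.Computability.Cryptography.regev_lwe_to_sivp_quantum` (pqc.S19; Regev, J. ACM 56 (2009),
Thm 1.1), namely the QUANTUM half of the iterative step, **Lemma 3.14** ("second part of iterative
step"). After preparing the state `∑_{s ∈ ℤ_Rⁿ} ∑_{r ∈ ℤⁿ} ρ(L* s/R − L* r) |s⟩` (the periodic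
Gaussian of the lattice `Λ = L*/R` over its sublattice `L* = RΛ`, in the coordinates `s` of the
basis of `Λ`), the algorithm applies the quantum Fourier transform on `ℤ_Rⁿ`; the printed computation
(author's version arXiv:2401.03703, p. 20) of the new amplitudes is

  `∑_{s ∈ ℤ_Rⁿ} ∑_{r ∈ ℤⁿ} ρ(L* s/R − L* r) exp(2πi⟨s,t⟩/R) = ∑_{s ∈ ℤⁿ} ρ(L* s/R) exp(2πi⟨s,t⟩/R)
   = ∑_{x ∈ L*/R} ρ(x) exp(2πi⟨x, L t⟩) = det(RL) ∑_{y ∈ RL} ρ(y − L t)`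

"where the last equality follows from Lemma 2.14 [Poisson summation] and Eq. (7)". This file PROVES
that identity (theorems only, no named fact) for an arbitrary full-rank lattice `Λ` with a `ℤ`-basis
`e` (Regev: `Λ = L*/R`, `eᵢ = L*ᵢ/R`) and an arbitrary modulus `R ≥ 1`:

* `Regev2009.latticePt e m = ∑ mᵢ eᵢ` (the point with integer coordinates `m`), `Regev2009.dualPt`
  (`u_t = ∑ⱼ (tⱼ/R) e*ⱼ` for the dual basis `e*`; Regev's `L t`), and the pairing
  `⟪latticePt m, dualPt t⟫ = ⟨m, t⟩/R` (`inner_latticePt_dualPt`);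
* `Regev2009.periodicAmp Λ e R s = ∑_{y ∈ Λ} ρ(∑ sᵢeᵢ + R y)` — the amplitude of `|s⟩`;
* `Regev2009.euclidEquiv` — `ℤ_Rⁿ × ℤⁿ ≃ ℤⁿ`, `(s, r) ↦ s + R r` (the resummation "`= ∑_{s ∈ ℤⁿ}`");
* `Regev2009.qft_periodicAmp_eq` — **the identity**: for every `t ∈ ℤ_Rⁿ`,
  `∑_{s ∈ ℤ_Rⁿ} periodicAmp(s) · 𝐞(⟨s,t⟩/R) = vol(Λ)⁻¹ · ∑_{y ∈ Λ*} ρ(y − u_t)`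
  (`vol(Λ)⁻¹ = det(Λ*)` = Regev's `det(RL)`; `Λ* = dualLattice Λ` is `RL` in the application, the
  `ℤ`-span of the dual basis `e*ⱼ = R Lⱼ`, `dualLattice_eq_span_dualBasis`).

The unitary QFT carries the extra constant `R^{-n/2}`; all constants disappear on normalisation.

## References

* O. Regev, *On lattices, learning with errors, random linear codes, and cryptography*, J. ACM 56
  (2009), art. 34; author's version arXiv:2401.03703, Lemma 3.14 (proof, p. 20), Lemma 2.14 and
  eq. (7) (Poisson summation with a character) [Regev2009].
* D. Micciancio, O. Regev, *Worst-case to average-case reductions based on Gaussian measures*,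
  SIAM J. Comput. 37 (2007), proof of Lemma 4.5, eq. (11) (tree:
  `tsum_fourierChar_smul_gaussianFunction_sub_eq`) [MicciancioRegev2007].
-/

noncomputable section

open Module MeasureTheory Complex
open scoped Real InnerProductSpace FourierTransform

namespace Literature.Algebra.EuclideanLattices

namespace Regev2009

/-! ### Euclidean division `ℤ_Rⁿ × ℤⁿ ≃ ℤⁿ` and the character -/

section Euclid

variable {ι : Type*} [Fintype ι]

/-- **Euclidean division, coordinatewise**: `ℤ_Rⁿ × ℤⁿ ≃ ℤⁿ`, `(s, r) ↦ (sᵢ + R rᵢ)ᵢ` with inverse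
`m ↦ (m mod R, m div R)`. [folklore] -/
def euclidEquiv (R : ℕ) [NeZero R] : (ι → ZMod R) × (ι → ℤ) ≃ (ι → ℤ) where
  toFun p := fun i => ((p.1 i).val : ℤ) + R * p.2 i
  invFun m := (fun i => (m i : ZMod R), fun i => m i / R)
  left_inv := by
    rintro ⟨s, r⟩
    have hR : (0 : ℤ) < R := by exact_mod_cast Nat.pos_of_ne_zero (NeZero.ne R)
    refine Prod.ext (funext fun i => ?_) (funext fun i => ?_)
    · simp only
      push_cast
      rw [ZMod.natCast_zmod_val, ZMod.natCast_self, zero_mul, add_zero]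
    · simp only
      rw [Int.add_mul_ediv_left _ _ hR.ne', Int.ediv_eq_zero_of_lt (by positivity)
        (by exact_mod_cast ZMod.val_lt (s i)), zero_add]
  right_inv := by
    intro m
    funext i
    simp only
    rw [ZMod.val_intCast, Int.emod_add_mul_ediv]

/-- The character `𝐞(⟨m, t⟩/R)` only depends on `m mod R`. [folklore] -/
theorem fourierChar_sum_add_mul (R : ℕ) [NeZero R] (s : ι → ZMod R) (r : ι → ℤ) (t : ι → ZMod R) :
    𝐞 ((∑ i, ((((s i).val : ℤ) + R * r i : ℤ) : ℝ) * (t i).val) / R) =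
      𝐞 ((∑ i, (((s i).val : ℤ) : ℝ) * (t i).val) / R) := by
  have hR : (R : ℝ) ≠ 0 := by exact_mod_cast NeZero.ne R
  have hsplit : (∑ i, ((((s i).val : ℤ) + R * r i : ℤ) : ℝ) * (t i).val) / R =
      (∑ i, (((s i).val : ℤ) : ℝ) * (t i).val) / R + ((∑ i, r i * (t i).val : ℤ) : ℝ) := by
    push_cast
    have h : ∑ i, (((s i).val : ℝ) + (R : ℝ) * (r i : ℝ)) * ((t i).val : ℝ) =
        ∑ i, ((s i).val : ℝ) * ((t i).val : ℝ) + (R : ℝ) * ∑ i, (r i : ℝ) * ((t i).val : ℝ) := by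
      rw [Finset.mul_sum, ← Finset.sum_add_distrib]
      exact Finset.sum_congr rfl fun i _ => by ring
    rw [h, add_div, mul_div_cancel_left₀ _ hR]
  rw [hsplit, AddChar.map_add_eq_mul]
  suffices h : 𝐞 (((∑ i, r i * (t i).val : ℤ) : ℝ)) = 1 by rw [h, mul_one]
  apply Circle.coe_inj.1
  rw [Real.fourierChar_apply, Circle.coe_one]
  have := Complex.exp_int_mul_two_pi_mul_I (∑ i, r i * (t i).val)
  convert this using 2
  push_cast
  ring

end Euclid

/-! ### Lattice points by integer coordinates -/

variable {V : Type*} [NormedAddCommGroup V] [InnerProductSpace ℝ V]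
variable {ι : Type*} [Fintype ι]
variable (Λ : Submodule ℤ V) (e : Basis ι ℤ Λ)

/-- The lattice point with integer coordinates `m` in the `ℤ`-basis `e`: `∑ᵢ mᵢ eᵢ`. [folklore] -/
def latticePt (m : ι → ℤ) : V := ((e.equivFun.symm m : Λ) : V)

/-- `latticePt` as a real linear combination. [folklore] -/
theorem latticePt_eq_sum (m : ι → ℤ) : latticePt Λ e m = ∑ i, (m i : ℝ) • ((e i : Λ) : V) := by
  rw [latticePt, Basis.equivFun_symm_apply, Submodule.coe_sum]
  refine Finset.sum_congr rfl fun i _ => ?_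
  rw [Submodule.coe_smul, ← Int.cast_smul_eq_zsmul ℝ]

/-- `latticePt` is additive and `ℤ`-homogeneous. [folklore] -/
theorem latticePt_add_smul (m r : ι → ℤ) (R : ℤ) :
    latticePt Λ e (m + R • r) = latticePt Λ e m + (R : ℝ) • latticePt Λ e r := by
  simp only [latticePt, map_add, map_smul, Submodule.coe_add, Submodule.coe_smul, ← Int.cast_smul_eq_zsmul ℝ]

omit [InnerProductSpace ℝ V] in
/-- Every lattice vector is `latticePt` of its coordinates. [folklore] -/
theorem latticePt_equivFun (y : Λ) : latticePt Λ e (e.equivFun y) = (y : V) := by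
  rw [latticePt, LinearEquiv.symm_apply_apply]

/-- **The amplitude of `|s⟩`**: `∑_{y ∈ Λ} ρ(∑ᵢ sᵢ eᵢ + R y)`, the Gaussian mass of the coset of the
sublattice `RΛ` through the point of coordinates `s` (Regev: `∑_{r ∈ ℤⁿ} ρ(L* s/R − L* r)`; the sign
of `r` is immaterial). [cite: Regev2009, Lemma 3.14 (eq. (12) and proof)] -/
def periodicAmp (R : ℕ) (s : ι → ZMod R) : ℝ :=
  ∑' y : Λ, gaussianFunction 1 (latticePt Λ e (fun i => ((s i).val : ℤ)) + (R : ℝ) • (y : V))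

variable [FiniteDimensional ℝ V] [DiscreteTopology Λ]

/-- Summability of the Gaussian over the lattice, indexed by integer coordinates. [folklore] -/
theorem summable_gaussianFunction_latticePt :
    Summable fun m : ι → ℤ => gaussianFunction 1 (latticePt Λ e m) := by
  have h := (summable_gaussianFunction_sub Λ one_ne_zero (0 : V))
  rw [← e.equivFun.symm.toEquiv.summable_iff] at h
  refine h.congr fun m => ?_
  simp [latticePt, sub_zero]

/-! ### The dual basis and the dual point `u_t` -/

variable [IsZLattice ℝ Λ] [DecidableEq ι]

/-- **The dual basis vector `e*ⱼ`** (w.r.t. the inner product): `⟪eᵢ, e*ⱼ⟫ = δᵢⱼ`. In Regev's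
Lemma 3.14 (with `eᵢ = L*ᵢ/R`) this is `e*ⱼ = R Lⱼ`. [folklore] -/
def dualVec (j : ι) : V :=
  LinearMap.BilinForm.dualBasis (innerₗ V : LinearMap.BilinForm ℝ V) innerₗ_nondegenerate (e.ofZLatticeBasis ℝ Λ) j

/-- `⟪eᵢ, e*ⱼ⟫ = δᵢⱼ`. [folklore] -/
theorem inner_basis_dualVec (i j : ι) : ⟪((e i : Λ) : V), dualVec Λ e j⟫_ℝ = if i = j then 1 else 0 := by
  have h := LinearMap.BilinForm.apply_dualBasis_left (B := (innerₗ V : LinearMap.BilinForm ℝ V))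
    innerₗ_nondegenerate (e.ofZLatticeBasis ℝ Λ) j i
  rw [innerₗ_apply_apply, Basis.ofZLatticeBasis_apply] at h
  rw [real_inner_comm]
  exact h

/-- **The dual point `u_t = ∑ⱼ (tⱼ/R) e*ⱼ`** attached to a frequency `t ∈ ℤ_Rⁿ` (Regev: `L t`, read
through the representatives `tⱼ ∈ {0, …, R-1}`; another choice of representatives moves `u_t` by an
element of `Λ* = span e*`, which does not change the periodic sum below). [cite: Regev2009, Lemma 3.14 (proof)] -/
def dualPt (R : ℕ) (t : ι → ZMod R) : V := ∑ j, (((t j).val : ℝ) / R) • dualVec Λ e j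

/-- **The pairing**: `⟪∑ mᵢeᵢ, u_t⟫ = (∑ᵢ mᵢ tᵢ)/R` ("`⟨(L*)⁻¹x, t⟩ = ⟨x, L t⟩`" in the printed
proof). [cite: Regev2009, Lemma 3.14 (proof)] -/
theorem inner_latticePt_dualPt (R : ℕ) (m : ι → ℤ) (t : ι → ZMod R) :
    ⟪latticePt Λ e m, dualPt Λ e R t⟫_ℝ = (∑ i, (m i : ℝ) * (t i).val) / R := by
  rw [latticePt_eq_sum, dualPt, sum_inner, Finset.sum_div]
  refine Finset.sum_congr rfl fun i _ => ?_
  rw [inner_sum, Finset.sum_eq_single i]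
  · rw [real_inner_smul_left, real_inner_smul_right, inner_basis_dualVec, if_pos rfl]; ring
  · intro j _ hji
    rw [real_inner_smul_left, real_inner_smul_right, inner_basis_dualVec, if_neg (Ne.symm hji)]; ring
  · intro h; exact absurd (Finset.mem_univ i) h

/-! ### The identity -/

section Fourier

variable [MeasurableSpace V] [BorelSpace V]

/-- **Regev 2009, Lemma 3.14, the Fourier identity.** For a full-rank lattice `Λ` with `ℤ`-basis `e`,
a modulus `R ≥ 1` and a frequency `t ∈ ℤ_Rⁿ`:
`∑_{s ∈ ℤ_Rⁿ} (∑_{y ∈ Λ} ρ(∑ sᵢeᵢ + R y)) · 𝐞(⟨s,t⟩/R) = vol(Λ)⁻¹ · ∑_{y ∈ Λ*} ρ(y − u_t)`,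
`u_t = ∑ⱼ (tⱼ/R) e*ⱼ` — the printed chain "`∑_{s ∈ ℤ_Rⁿ} ∑_r ρ(L*s/R − L*r) e^{2πi⟨s,t⟩/R} =
∑_{s ∈ ℤⁿ} ρ(L*s/R) e^{2πi⟨s,t⟩/R} = ∑_{x ∈ L*/R} ρ(x) e^{2πi⟨x, Lt⟩} = det(RL) ∑_{y ∈ RL} ρ(y − Lt)`"
with `Λ = L*/R`, `e*ⱼ = RLⱼ`, `vol(Λ)⁻¹ = det(RL)`: Euclidean resummation (`euclidEquiv`), the
pairing `inner_latticePt_dualPt`, and the modulated Poisson identity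
(`tsum_fourierChar_smul_gaussianFunction_sub_eq`). [cite: Regev2009, Lemma 3.14 (proof, p. 20)] -/
theorem qft_periodicAmp_eq (R : ℕ) [NeZero R] (t : ι → ZMod R) :
    ∑ s : ι → ZMod R, ((periodicAmp Λ e R s : ℝ) : ℂ) * (𝐞 ((∑ i, (((s i).val : ℤ) : ℝ) * (t i).val) / R) : ℂ) =
      ((ZLattice.covolume Λ)⁻¹ : ℝ) * ∑' y : dualLattice Λ, ((gaussianFunction 1 ((y : V) - dualPt Λ e R t) : ℝ) : ℂ) := by
  classical
  -- the summand over `ℤⁿ` after resummation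
  set G : (ι → ℤ) → ℂ := fun m =>
    ((gaussianFunction 1 (latticePt Λ e m) : ℝ) : ℂ) * (𝐞 ((∑ i, ((m i : ℤ) : ℝ) * (t i).val) / R) : ℂ) with hG
  have hGsum : Summable G := by
    refine Summable.of_norm ?_
    refine (summable_gaussianFunction_latticePt Λ e).congr fun m => ?_
    rw [hG, norm_mul, Complex.norm_real, Real.norm_eq_abs, abs_of_pos (gaussianFunction_pos _ _),
      Circle.norm_coe, mul_one]
  -- (1) unfold the amplitude and pass to integer coordinates of `y`
  have h1 : ∀ s : ι → ZMod R, ((periodicAmp Λ e R s : ℝ) : ℂ) * (𝐞 ((∑ i, (((s i).val : ℤ) : ℝ) * (t i).val) / R) : ℂ) =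
      ∑' r : ι → ℤ, G (euclidEquiv R (s, r)) := by
    intro s
    rw [periodicAmp, Complex.ofReal_tsum, ← tsum_mul_right, ← e.equivFun.symm.toEquiv.tsum_eq]
    refine tsum_congr fun r => ?_
    simp only [hG, euclidEquiv, Equiv.coe_fn_mk, LinearEquiv.coe_toEquiv]
    rw [fourierChar_sum_add_mul]
    congr 2
    rw [show (fun i => ((s i).val : ℤ) + R * r i) = (fun i => ((s i).val : ℤ)) + (R : ℤ) • r from
      funext fun i => by simp, latticePt_add_smul, Int.cast_natCast]
    rfl
  -- (2) resum over `ℤⁿ`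
  have h2 : ∑ s : ι → ZMod R, ∑' r : ι → ℤ, G (euclidEquiv R (s, r)) = ∑' m : ι → ℤ, G m := by
    have hs : Summable fun p : (ι → ZMod R) × (ι → ℤ) => G (euclidEquiv R p) :=
      (euclidEquiv R).summable_iff.2 hGsum
    rw [← (euclidEquiv R).tsum_eq G, hs.tsum_prod' (fun s => hs.comp_injective (Prod.mk_right_injective s)),
      tsum_fintype]
  -- (3) back to the lattice, with the character `𝐞(⟪x, u_t⟫)`
  have h3 : ∑' m : ι → ℤ, G m =
      ∑' x : Λ, 𝐞 ⟪(x : V), dualPt Λ e R t⟫_ℝ • ((gaussianFunction 1 ((x : V) - 0) : ℝ) : ℂ) := by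
    rw [← e.equivFun.toEquiv.tsum_eq]
    refine tsum_congr fun x => ?_
    simp only [hG, LinearEquiv.coe_toEquiv, Circle.smul_def, smul_eq_mul, sub_zero]
    rw [mul_comm, ← latticePt_equivFun Λ e x, inner_latticePt_dualPt, latticePt_equivFun]
  -- (4) Poisson summation with a character
  rw [Finset.sum_congr rfl fun s _ => h1 s, h2, h3,
    tsum_fourierChar_smul_gaussianFunction_sub_eq Λ one_pos 0 (dualPt Λ e R t), Complex.real_smul]
  congr 1
  refine tsum_congr fun y => ?_
  simp

end Fourier

end Regev2009

end Literature.Algebra.EuclideanLattices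

end
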